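import Summits.ValiantsHypothesis.ValiantsHypothesis.Theorems.GrenetZeonPolySizeQPAlgebraHomogeneousCorner
import Summits.ValiantsHypothesis.ValiantsHypothesis.Theorems.GrenetZeonAbelianizationQPGorenstein
import HarnessLib

/-!
# Crux `GrenetZeon.PolySizeQPAlgebra` (stmt-ValiantsHypothesis-8064) — NORMAL FORM OF THE DEGREE-FLOOR
# CORNER `m = n`: sums of HOMOGENEOUS LINEAR determinants over LOCAL FROBENIUS algebras

The open part of the `c = 1` box of the piece (after `GrenetZeonPolySizeQPAlgebraSliceTwo.lean`) is
`m ∈ {n, n+1}`, `3 ≤ s ≤ 2·2^(log₂ n)`.  For its half `m = n` (= `deg per_n`) this file records the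
witness normal form obtained by composing two tree theorems:

* ✓ `exists_local_frobenius_decomposition` (`GrenetZeonAbelianizationQPGorenstein.lean`, `k` algebraically
  closed): every `(m, s)`-representation is a sum of `t ≤ s` representations of the SAME matrix size over
  LOCAL FROBENIUS pairs `(Rᵢ, λᵢ)` (`λᵢ` nondegenerate, `(ker φᵢ)^s = 0`), `Σ dim Rᵢ ≤ s`;
* ✓ `homogeneousComponent_det_fin` (`GrenetZeonPolySizeQPAlgebraHomogeneousCorner.lean`, any commutative
  ring): the degree-`m` component of the determinant of an affine `m × m` matrix is the determinant of its
  matrix of linear parts.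

Result `exists_homogeneous_local_frobenius_decomposition`: a FORM `f` of degree `n` with an
`(n, s)`-representation is `f = Σ_{i<t} Fᵢ` with every `Fᵢ` HOMOGENEOUS of degree `n` and represented by an
`n × n` matrix of LINEAR FORMS over a local Frobenius algebra `Rᵢ`, `t ≤ s`, `Σ dim Rᵢ ≤ s` (take the
degree-`n` components of the local pieces; they are represented by the linear parts).  For the permanent
(`exists_homogeneous_local_frobenius_perPoly`): any `(n, s)`-representation of `per_n` is WLOG
`per_n = Σᵢ λᵢ(det Lᵢ)` with `Lᵢ` linear `n × n` over local Frobenius `(Rᵢ, λᵢ)` — the object the next rung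
(`s = 3`: `R ∈ {ℂ³, ℂ × ℂ[ε]/ε², ℂ[ε]/ε³}`, the last being the only local Frobenius algebra of dimension 3)
has to exclude.

Honest framing: a normal form (composition of landed lemmas), no exclusion; the registered stubs of 8064 are
untouched; nothing here bears on VP ≠ VNP.  Axioms `propext`, `Classical.choice`, `Quot.sound`.
-/

set_option linter.dupNamespace false

noncomputable section

namespace Summit.ValiantsHypothesis.ValiantsHypothesis.Theorems.GrenetZeonPolySizeQPAlgebra

open MvPolynomial Matrix
open Literature.Computability.AlgebraicComplexity

universe u v

section LocalForm

variable {k : Type u} [Field k] {σ : Type v}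

/-- **Homogeneous local Frobenius normal form at the degree floor.** Over an algebraically closed field, a
form `f` of degree `n` with an `(n, s)`-representation is a sum of `t ≤ s` forms of degree `n`, each
represented by an `n × n` matrix of LINEAR forms over a local Frobenius algebra (`λᵢ` nondegenerate,
`(ker φᵢ)^s = 0`), with `Σ dim Rᵢ ≤ s`. [folklore] -/
theorem exists_homogeneous_local_frobenius_decomposition [IsAlgClosed k] {f : MvPolynomial σ k}
    {n s : ℕ} (hf : f.IsHomogeneous n) (h : HasAlgDetRepr f n s) :
    ∃ (t : ℕ) (F : Fin t → MvPolynomial σ k) (dim : Fin t → ℕ),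
      t ≤ s ∧ ∑ i, dim i ≤ s ∧ f = ∑ i, F i ∧ (∀ i, (F i).IsHomogeneous n) ∧
        ∀ i, ∃ (Rᵢ : Type u) (_ : CommRing Rᵢ) (_ : Algebra k Rᵢ) (_ : Module.Finite k Rᵢ)
          (φ : Rᵢ →ₐ[k] k), RingHom.ker (φ : Rᵢ →+* k) ^ s = ⊥ ∧ Module.finrank k Rᵢ = dim i ∧
            ∃ (lᵢ : Rᵢ →ₗ[k] k) (Aᵢ : Matrix (Fin n) (Fin n) (MvPolynomial σ Rᵢ)),
              (∀ a b, (Aᵢ a b).IsHomogeneous 1) ∧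
                (∀ d : σ →₀ ℕ, lᵢ (coeff d Aᵢ.det) = coeff d (F i)) ∧
                  ∀ r : Rᵢ, (∀ x, lᵢ (x * r) = 0) → r = 0 := by
  obtain ⟨t, F, dim, ht, hdim, hfF, hloc⟩ := exists_local_frobenius_decomposition h
  refine ⟨t, fun i => homogeneousComponent n (F i), dim, ht, hdim, ?_,
    fun i => homogeneousComponent_isHomogeneous n _, fun i => ?_⟩
  · have hself : homogeneousComponent n f = f := by
      rw [homogeneousComponent_eq_of_isHomogeneous hf, if_pos rfl]
    calc f = homogeneousComponent n f := hself.symm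
      _ = ∑ i, homogeneousComponent n (F i) := by rw [hfF, map_sum]
  · obtain ⟨R, _, _, _, φ, hker, hdimR, l, A, hA, hcoeff, hnondeg⟩ := hloc i
    refine ⟨R, ‹_›, ‹_›, ‹_›, φ, hker, hdimR, l, A.map (homogeneousComponent 1),
      isHomogeneous_map_homogeneousComponent_one A, fun d => ?_, hnondeg⟩
    rw [← homogeneousComponent_det_fin A hA, coeff_homogeneousComponent, coeff_homogeneousComponent]
    split_ifs with hd
    · exact hcoeff d
    · rw [map_zero]

end LocalForm

/-- **The permanent at the degree floor.** Any `(n, s)`-representation of `per_n` over `ℂ` is WLOG a sum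
`per_n = Σ_{i<t} λᵢ(det Lᵢ)` (coefficientwise, through forms `Fᵢ` of degree `n` summing to `per_n`) with
`Lᵢ` an `n × n` matrix of LINEAR forms over a local Frobenius algebra `Rᵢ`, `t ≤ s`, `Σ dim Rᵢ ≤ s`.
[folklore] -/
theorem exists_homogeneous_local_frobenius_perPoly {n s : ℕ}
    (h : HasAlgDetRepr (perPoly (Fin n) ℂ) n s) :
    ∃ (t : ℕ) (F : Fin t → MvPolynomial (Fin n × Fin n) ℂ) (dim : Fin t → ℕ),
      t ≤ s ∧ ∑ i, dim i ≤ s ∧ perPoly (Fin n) ℂ = ∑ i, F i ∧ (∀ i, (F i).IsHomogeneous n) ∧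
        ∀ i, ∃ (Rᵢ : Type) (_ : CommRing Rᵢ) (_ : Algebra ℂ Rᵢ) (_ : Module.Finite ℂ Rᵢ)
          (φ : Rᵢ →ₐ[ℂ] ℂ), RingHom.ker (φ : Rᵢ →+* ℂ) ^ s = ⊥ ∧ Module.finrank ℂ Rᵢ = dim i ∧
            ∃ (lᵢ : Rᵢ →ₗ[ℂ] ℂ) (Aᵢ : Matrix (Fin n) (Fin n) (MvPolynomial (Fin n × Fin n) Rᵢ)),
              (∀ a b, (Aᵢ a b).IsHomogeneous 1) ∧
                (∀ d : (Fin n × Fin n) →₀ ℕ, lᵢ (coeff d Aᵢ.det) = coeff d (F i)) ∧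
                  ∀ r : Rᵢ, (∀ x, lᵢ (x * r) = 0) → r = 0 := by
  have hper : (perPoly (Fin n) ℂ).IsHomogeneous n := by
    have h := perPoly_isHomogeneous (n := Fin n) (k := ℂ)
    rwa [Fintype.card_fin] at h
  exact exists_homogeneous_local_frobenius_decomposition hper h

end Summit.ValiantsHypothesis.ValiantsHypothesis.Theorems.GrenetZeonPolySizeQPAlgebra

end
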